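import Summits.ResolutionOfSingularities.ResolutionOfSingularities.Theorems.WeightedInvariantJOpenPresentationLE3Defs
import Summits.ResolutionOfSingularities.ResolutionOfSingularities.Theorems.WeightedInvariantJOpenPresentationLE3Assembly
import Summits.ResolutionOfSingularities.ResolutionOfSingularities.Theorems.WeightedInvariantTieFiniteCovering
import Summits.ResolutionOfSingularities.ResolutionOfSingularities.Theorems.WeightedInvariantTieFreeModelPackage
import HarnessLib

/-!
# (open″)≤3 for the pair of record `(ι₃ᵗ, J₃ᵗ)` — THE REGIME ASSEMBLY IN NAMED FORM, and input (T) reduced to the KEY finiteness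
# `finite_tiePrimes_over` (Δ10-d): `TieFreeAlongCurveLE3 p → PointBodyLE3 p 0 0 → PointBodyLE3 p 0 1 → PointBodyLE3 p 1 0 →
# JOpenPresentationForallSingLE 3 p iotaFlatT jFlatT`, and `(Δ10-d) → TieFreeAlongCurveLE3 p` (door `HypersurfaceCentreConstruction`,
# stmt-ResolutionOfSingularities-19897; P3 rung clause h8; DEAL (o52) SPLIT / KEY (o52-T) / SPEC (Δ10) of res-L1-w43-plan-1; hand res-D-brk-1)

Topic: `Summits/ResolutionOfSingularities/ResolutionOfSingularities/Theorems`. Helper for the door item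
`HypersurfaceCentreConstruction` (stmt-ResolutionOfSingularities-19897, route `WeightedInvariant`), line `local-engine`
(L W4.3), def-free.

* `JOpenLE3.jOpenPresentationForallSingLE_three_of_bodies` — the named corollary of res-D-brk-1's
  `jOpenPresentationForallSingLE_three_of` (`…JOpenPresentationLE3Assembly`, p555392) over the input shapes of
  `…JOpenPresentationLE3Defs` (p553420): the registrar's key for clause h8 of `PRungGrHomLE 3 p iotaFlatT jFlatT`;
  `…_of_pointBody` (the three point regimes bundled as `∀ e t, PointBodyLE3 p e t`).
* `JOpenLE3.tieFreeAlongCurveLE3_of_finite` — the registrar's (Δ10-e) GLUE (SPEC (Δ10) rev 2 `TieFreeNearCurve_sketch.lean`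
  d99978ac1e717962, PROVED there against a token-identical restatement) applied to the landed pieces: the KEY finiteness (Δ10-d)
  `finite_tiePrimes_over` (statement as a hypothesis, verbatim; res-type-047's deal (o52-T-b)) and res-D-brk-1's (Δ10-e1)
  `TieFinite.exists_modelPosition_package` (p555827) give INPUT (T) `TieFreeAlongCurveLE3 p`; heights from
  `…TieFiniteCovering` (p555504: `height_le_of_ringKrullDim_le`, `height_eq_of_ringKrullDim_eq`, `exists_not_mem_forall_mem`).
* `JOpenLE3.jOpenPresentationForallSingLE_three_of_finite` — hence h8 from (Δ10-d) and the three point bodies.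

[OURS · L1 W4.3 · (o52-asm)/(o52-T)]  Replaces the role of NO printed item; NOT a statement of the manuscript
[claim: Hironaka2017, status: under-review]. AI work, weaker than expert review.  Pure commutative algebra; no named facts.

## References

* res-L1-w43-plan-1, IOTA3-DESIGN v1.3 §8.4, DEAL (o52) SPLIT, KEY (o52-T), SPEC (Δ10) rev 2, REGISTRAR RULING #13 (OURS, AI planning).
* H. Matsumura, *Commutative Ring Theory* (1987), §5 / Thm. 13.5 (height and dimension). [Matsumura1987]
-/

noncomputable section

open IsLocalRing Literature.AlgebraicGeometry.Resolution
open Summit.ResolutionOfSingularities.ResolutionOfSingularities.Cruxes.HypersurfaceCentreConstruction.LocalEngine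
open Summit.ResolutionOfSingularities.ResolutionOfSingularities.Cruxes.HypersurfaceCentreConstruction.LocalEngine.Iota3
open Summit.ResolutionOfSingularities.ResolutionOfSingularities.Cruxes.HypersurfaceCentreConstruction.LocalEngine.TieFinite

set_option linter.dupNamespace false -- mandated namespace of this single-conjunct summit

namespace Summit.ResolutionOfSingularities.ResolutionOfSingularities.Theorems

namespace JOpenLE3

open ContactCylinder

/-! ## The named assembly -/

/-- **(open″)≤3 FOR THE PAIR OF RECORD FROM THE NAMED INPUTS**: `JOpenPresentationForallSingLE 3 p iotaFlatT jFlatT` from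
`TieFreeAlongCurveLE3 p` (T) and the point bodies `PointBodyLE3 p 0 0` (ISOLATED), `PointBodyLE3 p 0 1` (TIE), `PointBodyLE3 p 1 0`
(CROSSING). [OURS · L1 W4.3 · (o52-asm)] -/
theorem jOpenPresentationForallSingLE_three_of_bodies (p : ℕ) (hT : TieFreeAlongCurveLE3 p)
    (hP00 : PointBodyLE3 p 0 0) (hP01 : PointBodyLE3 p 0 1) (hP10 : PointBodyLE3 p 1 0) :
    JOpenPresentationForallSingLE 3 p iotaFlatT jFlatT :=
  jOpenPresentationForallSingLE_three_of p hT hP00 hP01 hP10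

/-- The same with the point regimes bundled: `(∀ e t, PointBodyLE3 p e t)` and (T) give the clause. [OURS · L1 W4.3 · (o52-asm)] -/
theorem jOpenPresentationForallSingLE_three_of_pointBody (p : ℕ) (hT : TieFreeAlongCurveLE3 p)
    (hP : ∀ e t : Ordinal.{0}, PointBodyLE3 p e t) : JOpenPresentationForallSingLE 3 p iotaFlatT jFlatT :=
  jOpenPresentationForallSingLE_three_of_bodies p hT (hP 0 0) (hP 0 1) (hP 1 0)

/-! ## Input (T) from the KEY finiteness (Δ10-d) -/

/-- **(Δ10-e) GLUE APPLIED: the KEY finiteness of the tie primes of local dimension `≤ 3` over a height-two equimultiple curve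
((Δ10-d) `finite_tiePrimes_over`, here a hypothesis with the SPEC's statement verbatim) gives INPUT (T) `TieFreeAlongCurveLE3 p`**
(model-position package = res-D-brk-1's `TieFinite.exists_modelPosition_package`; `h := h₁ · a` with `a ∉ 𝔪` in every member of
the finite set — no member is `≤ 𝔪`: a tie prime has height `3 ≥ ht 𝔪` and `𝔪` itself is not a tie; the registrar's proof,
SPEC (Δ10) rev 2). [OURS · L1 W4.3 · (o52-T)] -/
theorem tieFreeAlongCurveLE3_of_finite (p : ℕ)
    (hkey : ∀ (k₀ : Type) [Field k₀] [PerfectField k₀] (A : Type) [CommRing A] [Algebra k₀ A] [Algebra.FiniteType k₀ A]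
      (F : A) (𝔭 : Ideal A) [𝔭.IsPrime] [IsRegularLocalRing (Localization.AtPrime 𝔭)],
      ringKrullDim (Localization.AtPrime 𝔭) = (2 : ℕ) →
      algebraMap A (Localization.AtPrime 𝔭) F ≠ 0 →
      algebraMap A (Localization.AtPrime 𝔭) F ∈ (maximalIdeal (Localization.AtPrime 𝔭)) ^ 2 →
      {𝔮 : PrimeSpectrum A | 𝔭 < 𝔮.asIdeal ∧ ringKrullDim (Localization.AtPrime 𝔮.asIdeal) ≤ (3 : ℕ) ∧
        IsTiePosition (Localization.AtPrime 𝔮.asIdeal) (algebraMap A (Localization.AtPrime 𝔮.asIdeal) F) ∧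
        topStratumPrime iotaOrdEps (Localization.AtPrime 𝔮.asIdeal)
          (algebraMap A (Localization.AtPrime 𝔮.asIdeal) F) = 𝔭.map (algebraMap A (Localization.AtPrime 𝔮.asIdeal))}.Finite) :
    TieFreeAlongCurveLE3 p := by
  intro k₀ _ _ _ A _ _ _ 𝔪 _ F 𝔭 _ h𝔭𝔪 hreg hdim𝔪 hF0 hF2 hdim𝔭 hEord h𝔪τ
  classical
  haveI := hreg
  haveI : IsNoetherianRing A := Algebra.FiniteType.isNoetherianRing k₀ A
  obtain ⟨hreg𝔭, hF0𝔭, hF2𝔭, h₁, hh₁, hgen⟩ := exists_modelPosition_package k₀ A 𝔪 F 𝔭 h𝔭𝔪 hF0 hF2 hdim𝔭 hEord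
  haveI := hreg𝔭
  have hfin := hkey k₀ A F 𝔭 hdim𝔭 hF0𝔭 hF2𝔭
  -- no member of the KEY set lies in `𝔪`
  have h𝔪3 : 𝔪.height ≤ 3 := height_le_of_ringKrullDim_le hdim𝔪
  have hnot : ∀ 𝔮 ∈ {𝔮 : PrimeSpectrum A | 𝔭 < 𝔮.asIdeal ∧ ringKrullDim (Localization.AtPrime 𝔮.asIdeal) ≤ (3 : ℕ) ∧
        IsTiePosition (Localization.AtPrime 𝔮.asIdeal) (algebraMap A (Localization.AtPrime 𝔮.asIdeal) F) ∧
        topStratumPrime iotaOrdEps (Localization.AtPrime 𝔮.asIdeal)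
          (algebraMap A (Localization.AtPrime 𝔮.asIdeal) F) = 𝔭.map (algebraMap A (Localization.AtPrime 𝔮.asIdeal))},
      ¬ 𝔮.asIdeal ≤ 𝔪 := by
    rintro 𝔮 ⟨-, -, htie, -⟩ hle
    have h𝔮3 : 𝔮.asIdeal.height = 3 := by
      have h3 : ringKrullDim (Localization.AtPrime 𝔮.asIdeal) = (3 : ℕ) := by
        rw [htie.2.1]; norm_cast
      exact height_eq_of_ringKrullDim_eq h3
    rcases eq_or_lt_of_le hle with h | h
    · subst h
      exact h𝔪τ htie
    · have h4 : 𝔮.asIdeal.height + 1 ≤ 𝔪.height := Ideal.height_add_one_le_of_lt_of_isPrime h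
      rw [h𝔮3] at h4
      exact absurd (h4.trans h𝔪3) (by decide)
  obtain ⟨a, ha𝔪, ha⟩ := exists_not_mem_forall_mem hfin hnot
  refine ⟨h₁ * a, fun hm => (‹𝔪.IsPrime›.mem_or_mem hm).elim hh₁ ha𝔪, ?_⟩
  intro 𝔮 _ hh𝔮 h𝔭𝔮 hdim𝔮 htie
  have hh₁𝔮 : h₁ ∉ 𝔮 := fun h => hh𝔮 (𝔮.mul_mem_right a h)
  have ha𝔮 : a ∉ 𝔮 := fun h => hh𝔮 (𝔮.mul_mem_left h₁ h)
  obtain ⟨hlt, htop⟩ := hgen 𝔮 hh₁𝔮 h𝔭𝔮 htie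
  exact ha𝔮 (ha ⟨𝔮, inferInstance⟩ ⟨hlt, hdim𝔮, htie, htop⟩)

/-- **h8 FROM THE KEY FINITENESS AND THE POINT BODIES**: (Δ10-d) `finite_tiePrimes_over` (as a hypothesis) and the three point bodies
give `JOpenPresentationForallSingLE 3 p iotaFlatT jFlatT`. [OURS · L1 W4.3 · (o52-asm)/(o52-T)] -/
theorem jOpenPresentationForallSingLE_three_of_finite (p : ℕ)
    (hkey : ∀ (k₀ : Type) [Field k₀] [PerfectField k₀] (A : Type) [CommRing A] [Algebra k₀ A] [Algebra.FiniteType k₀ A]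
      (F : A) (𝔭 : Ideal A) [𝔭.IsPrime] [IsRegularLocalRing (Localization.AtPrime 𝔭)],
      ringKrullDim (Localization.AtPrime 𝔭) = (2 : ℕ) →
      algebraMap A (Localization.AtPrime 𝔭) F ≠ 0 →
      algebraMap A (Localization.AtPrime 𝔭) F ∈ (maximalIdeal (Localization.AtPrime 𝔭)) ^ 2 →
      {𝔮 : PrimeSpectrum A | 𝔭 < 𝔮.asIdeal ∧ ringKrullDim (Localization.AtPrime 𝔮.asIdeal) ≤ (3 : ℕ) ∧
        IsTiePosition (Localization.AtPrime 𝔮.asIdeal) (algebraMap A (Localization.AtPrime 𝔮.asIdeal) F) ∧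
        topStratumPrime iotaOrdEps (Localization.AtPrime 𝔮.asIdeal)
          (algebraMap A (Localization.AtPrime 𝔮.asIdeal) F) = 𝔭.map (algebraMap A (Localization.AtPrime 𝔮.asIdeal))}.Finite)
    (hP00 : PointBodyLE3 p 0 0) (hP01 : PointBodyLE3 p 0 1) (hP10 : PointBodyLE3 p 1 0) :
    JOpenPresentationForallSingLE 3 p iotaFlatT jFlatT :=
  jOpenPresentationForallSingLE_three_of_bodies p (tieFreeAlongCurveLE3_of_finite p hkey) hP00 hP01 hP10

end JOpenLE3

end Summit.ResolutionOfSingularities.ResolutionOfSingularities.Theorems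

end
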